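import Summits.Ventures.LatticeQCDFlow.Scaling.FlowLadderConjugacy
import Summits.Ventures.LatticeQCDFlow.Scaling.ReplicaExchangeBareTorpid

/-!
HONEST FRAMING: exact (Metropolis-corrected) sampling algorithms for lattice gauge theory; figures
of merit are autocorrelation/cost numbers at stated couplings and volumes; no continuum-physics
claim.

# FlowLadderEquivariantCeiling — MAPS THAT CARRY A METASTABLE FAMILY ALONG THE LADDER DO NOT TUNNEL: FOR EVERY FAMILY OF
# ADJACENT BIJECTIONS `φ` AND EVERY FAMILY OF SETS `A_k` WITH `A_{k+1} = φ_k(A_k)`,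
# `Gap(ptFlowSampler t μ M φ) ≤ (1−t)·Σ_kQ_k(A_k,A_kᶜ)/((K+1)·Σ_kμ_k(A_k)μ_k(A_kᶜ))`; IMAGES FROZEN AT THE COLD LEVELS ⇒
# `Gap ≤ (1−t)·Q_0(A_0,A_0ᶜ)/((K+1)·K·v)` — THE SECTOR CEILING OF `Scaling/ReplicaExchangeFlowSwapDiffusive` WITHOUT THE
# SECTOR-PRESERVING HYPOTHESIS (lean-2 GEN-21, ours)

Venture-side (OURS).  Cell `lqcd-flow` (pub-lqcd), unit `pub-lqcd-lean-2-g21`, 2026-08-26.  Chapter I, eleventh file.  The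
no-go results for map-assisted exchange (`Scaling/ReplicaExchangeFlowSwapDiffusive`, `Scaling/FlowSwapCutMixingFloor`) assume
SECTOR-PRESERVING maps (`φ_j(A) = A`).  Level coordinates (`Scaling/FlowLadderConjugacy`) remove that hypothesis: in the
coordinates `x ↦ (L_k x_k)` the flow ladder IS the plain ladder for the pulled-back laws `ν_k = μ_k∘L_k⁻¹` and updates
`M^L_k`, and the plain sector ceiling of `Scaling/ReplicaExchangeBareTorpid`
(`Gap ≤ (1−t)Σ_kQ_k(B,Bᶜ)/((K+1)Σ_kν_k(B)ν_k(Bᶜ))` for ONE set `B`) pulls back to a ceiling for the LEVEL-DEPENDENT family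
`A_k = L_k⁻¹(B)` — exactly the families carried along by the maps, `A_{k+1} = φ_k(A_k)`.  So a flow that maps the metastable
set of level `k` onto a metastable set of level `k+1` — the same sector, ANOTHER sector, or any relabelled image — leaves the
ladder as torpid as without maps; only maps whose images of the hot level's sets are NOT metastable for the cold updates can
help.

## What is proved

* §1 (generic) `map_compl_equiv` (`(e B)ᶜ = e(Bᶜ)` for a bijection), `sum_relabel_set`, **`edgeMeasure_relabel_set`**
  (`Q_{π∘e, P∘e}(B,C) = Q_{π,P}(e B, e C)`).
* §2 **`flowLadder_spectralGap_le_imageFamily`** (level coordinates `L`, one set `B`, images `A_k = L_k⁻¹ B`);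
  `imageFamily_succ` (`A_{k+1} = φ_k(A_k)`); **`flowLadderEquivariant_spectralGap_le`** — for EVERY `φ` and every
  `φ`-equivariant family `A` (`A_{j+1} = φ_j(A_j)`):
  `Gap(ptFlowSampler t μ M φ) ≤ (1−t)·Σ_kQ_k(A_k,A_kᶜ)/((K+1)·Σ_kμ_k(A_k)μ_k(A_kᶜ))`;
  **`flowLadderEquivariantFrozen_spectralGap_le`** — images frozen at the cold levels (`Q_k(A_k,A_kᶜ) = 0`, `k ≠ 0`) and
  `μ_k(A_k)μ_k(A_kᶜ) ≥ v`: `Gap ≤ (1−t)·Q_0(A_0,A_0ᶜ)/((K+1)·K·v)` — order `K⁻²` whatever the maps and the hot replica.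

Reading (no numerics implied): a trained map helps replica exchange across a topological barrier only in so far as it
carries configurations of one sector at the hot coupling into SEVERAL sectors' basins at the cold coupling; a map that is a
bijection between (possibly different) sectors level by level is invisible to the `K`-law.  NOT CLAIMED: the converse
(floors for sector-mixing maps); continuous spaces; anything measured.  Literature grade (cell rule): OWN MECHANISM, NEW
TYPING; nothing cited as a fact; no new bib keys.
-/

noncomputable section

open Finset Function
open Literature.Probability.MarkovChains

namespace Summit.Ventures.LatticeQCDFlow.Scaling

/-! ## §1 Sets and edge measures in relabelled coordinates -/

section Generic

variable {X : Type*} [Fintype X] [DecidableEq X]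

/-- `(e B)ᶜ = e(Bᶜ)` for a bijection `e`. [ours] -/
theorem map_compl_equiv (e : X ≃ X) (B : Finset X) :
    (B.map e.toEmbedding)ᶜ = Bᶜ.map e.toEmbedding := by
  ext y
  rw [Finset.mem_compl, Finset.mem_map_equiv, Finset.mem_map_equiv, Finset.mem_compl]

omit [Fintype X] [DecidableEq X] in
/-- `Σ_{x ∈ B} g(e x) = Σ_{u ∈ e B} g(u)`. [ours] -/
theorem sum_relabel_set (e : X ≃ X) (B : Finset X) (g : X → ℝ) :
    ∑ x ∈ B, g (e x) = ∑ u ∈ B.map e.toEmbedding, g u := by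
  rw [Finset.sum_map]; rfl

omit [Fintype X] [DecidableEq X] in
/-- **Edge measures relabel:** `Q_{π∘e, P∘(e×e)}(B, C) = Q_{π,P}(e B, e C)`. [ours] -/
theorem edgeMeasure_relabel_set (e : X ≃ X) (π : X → ℝ) (P : X → X → ℝ) (B C : Finset X) :
    edgeMeasure (fun x => π (e x)) (fun x y => P (e x) (e y)) B C
      = edgeMeasure π P (B.map e.toEmbedding) (C.map e.toEmbedding) := by
  unfold edgeMeasure
  rw [Finset.sum_map]
  refine sum_congr rfl fun x _ => ?_
  rw [Finset.sum_map]
  rfl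

end Generic

/-! ## §2 The flow ladder: families carried along by the maps -/

variable {S : Type*} [Fintype S] [DecidableEq S] {K : ℕ} {μ : Fin (K + 1) → S → ℝ}
  {M : Fin (K + 1) → S → S → ℝ} {t : ℝ}

/-- **THE IMAGE-FAMILY CEILING IN LEVEL COORDINATES:** for level bijections `L`, one set `B` and its images
`A_k = L_k⁻¹(B)`: `Gap(ptFlowSampler t μ M φ^L) ≤ (1−t)·Σ_kQ_k(A_k,A_kᶜ)/((K+1)·Σ_kμ_k(A_k)μ_k(A_kᶜ))`
(`0 ≤ t ≤ 1`, `|S| ≥ 2`, `Σ_kμ_k(A_k)μ_k(A_kᶜ) > 0`). [ours] -/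
theorem flowLadder_spectralGap_le_imageFamily [Nontrivial S] (L : Fin (K + 1) → Equiv.Perm S) (B : Finset S)
    (hμ : ∀ k x, 0 < μ k x) (hμ1 : ∀ k, ∑ u, μ k u = 1) (hM : ∀ k, IsRowStochastic (M k))
    (hMrev : ∀ k, DetailedBalance (μ k) (M k)) (ht0 : 0 ≤ t) (ht1 : t ≤ 1)
    (hA : 0 < ∑ k, (∑ x ∈ B.map (L k).symm.toEmbedding, μ k x) * ∑ x ∈ (B.map (L k).symm.toEmbedding)ᶜ, μ k x) :
    spectralGap (tensorFun μ) (ptFlowSampler t μ M (fun j : Fin K => (L j.castSucc).trans (L j.succ).symm))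
      ≤ (1 - t) * (∑ k, edgeMeasure (μ k) (M k) (B.map (L k).symm.toEmbedding) (B.map (L k).symm.toEmbedding)ᶜ)
          / ((K + 1) * ∑ k, (∑ x ∈ B.map (L k).symm.toEmbedding, μ k x)
              * ∑ x ∈ (B.map (L k).symm.toEmbedding)ᶜ, μ k x) := by
  rw [ptFlowSampler_spectralGap_eq_conj L t μ M]
  -- the plain sector ceiling for the pulled-back laws and the conjugated updates, for the one set `B`
  have hmass : ∀ k : Fin (K + 1), ∑ x ∈ B, μ k ((L k).symm x) = ∑ x ∈ B.map (L k).symm.toEmbedding, μ k x :=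
    fun k => sum_relabel_set (L k).symm B (μ k)
  have hmassc : ∀ k : Fin (K + 1), ∑ x ∈ Bᶜ, μ k ((L k).symm x) = ∑ x ∈ (B.map (L k).symm.toEmbedding)ᶜ, μ k x :=
    fun k => by rw [sum_relabel_set (L k).symm Bᶜ (μ k), map_compl_equiv]
  have hedge : ∀ k : Fin (K + 1), edgeMeasure (fun u => μ k ((L k).symm u)) (fun u v => M k ((L k).symm u) ((L k).symm v)) B Bᶜ
      = edgeMeasure (μ k) (M k) (B.map (L k).symm.toEmbedding) (B.map (L k).symm.toEmbedding)ᶜ := fun k => by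
    rw [edgeMeasure_relabel_set (L k).symm (μ k) (M k) B Bᶜ, map_compl_equiv]
  have hA' : 0 < ∑ k, (∑ x ∈ B, μ k ((L k).symm x)) * ∑ x ∈ Bᶜ, μ k ((L k).symm x) := by
    simp only [hmass, hmassc]; exact hA
  have h := ptBare_spectralGap_le_sector (μ := fun i u => μ i ((L i).symm u))
    (M := fun i u v => M i ((L i).symm u) ((L i).symm v)) (t := t) (fun k u => hμ k _)
    (fun k => by rw [Equiv.sum_comp (L k).symm (μ k)]; exact hμ1 k)
    (fun k => ⟨fun u v => (hM k).1 _ _,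
      fun u => by simpa using (Equiv.sum_comp (L k).symm (fun v => M k ((L k).symm u) v)).trans ((hM k).2 _)⟩)
    (fun k u v => hMrev k _ _) ht0 ht1 B hA'
  simp only [hmass, hmassc, hedge] at h
  exact h

omit [Fintype S] [DecidableEq S] in
/-- The images of `B` along level coordinates with `L_{j+1}⁻¹ = φ_j∘L_j⁻¹` are carried by the maps:
`A_{j+1} = φ_j(A_j)`. [ours] -/
theorem imageFamily_succ (L : Fin (K + 1) → Equiv.Perm S) (φ : Fin K → Equiv.Perm S)
    (hLφ : ∀ j : Fin K, (L j.castSucc).trans (L j.succ).symm = φ j) (B : Finset S) (j : Fin K) :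
    B.map (L j.succ).symm.toEmbedding = (B.map (L j.castSucc).symm.toEmbedding).map (φ j).toEmbedding := by
  rw [Finset.map_map]
  congr 1
  ext u
  have h := Equiv.ext_iff.mp (hLφ j) ((L j.castSucc).symm u)
  simp only [Equiv.trans_apply, Equiv.apply_symm_apply] at h
  simp [h]

/-- **MAPS THAT CARRY A FAMILY OF SETS ALONG THE LADDER DO NOT TUNNEL OUT OF IT:** for EVERY family of adjacent bijections
`φ` and every `φ`-EQUIVARIANT family of sets (`A_{j+1} = φ_j(A_j)`), `0 ≤ t ≤ 1`, `|S| ≥ 2`, `Σ_kμ_k(A_k)μ_k(A_kᶜ) > 0`: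
`Gap(ptFlowSampler t μ M φ) ≤ (1−t)·Σ_kQ_k(A_k,A_kᶜ)/((K+1)·Σ_kμ_k(A_k)μ_k(A_kᶜ))`. [ours] -/
theorem flowLadderEquivariant_spectralGap_le [Nontrivial S] (φ : Fin K → Equiv.Perm S) (A : Fin (K + 1) → Finset S)
    (hAφ : ∀ j : Fin K, A j.succ = (A j.castSucc).map (φ j).toEmbedding)
    (hμ : ∀ k x, 0 < μ k x) (hμ1 : ∀ k, ∑ u, μ k u = 1) (hM : ∀ k, IsRowStochastic (M k))
    (hMrev : ∀ k, DetailedBalance (μ k) (M k)) (ht0 : 0 ≤ t) (ht1 : t ≤ 1)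
    (hA : 0 < ∑ k, (∑ x ∈ A k, μ k x) * ∑ x ∈ (A k)ᶜ, μ k x) :
    spectralGap (tensorFun μ) (ptFlowSampler t μ M φ)
      ≤ (1 - t) * (∑ k, edgeMeasure (μ k) (M k) (A k) (A k)ᶜ)
          / ((K + 1) * ∑ k, (∑ x ∈ A k, μ k x) * ∑ x ∈ (A k)ᶜ, μ k x) := by
  obtain ⟨L, hL0, hLφ⟩ := exists_levelMaps φ
  have hφ : φ = fun j : Fin K => (L j.castSucc).trans (L j.succ).symm := (funext hLφ).symm
  -- the equivariant family is the image family of `B = A 0`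
  have hAk : ∀ k : Fin (K + 1), A k = (A 0).map (L k).symm.toEmbedding := by
    intro k
    induction k using Fin.induction with
    | zero =>
      rw [hL0]
      ext u
      simp
    | succ j ih => rw [hAφ j, ih, imageFamily_succ L φ hLφ (A 0) j]
  have h := flowLadder_spectralGap_le_imageFamily (t := t) (M := M) L (A 0) hμ hμ1 hM hMrev ht0 ht1
    (by simp only [← hAk]; exact hA)
  simp only [← hAk] at h
  rw [hφ]
  exact h

/-- **IMAGES FROZEN AT THE COLD LEVELS:** if the cold updates never leave the images (`Q_k(A_k,A_kᶜ) = 0`, `k ≠ 0`) and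
`μ_k(A_k)μ_k(A_kᶜ) ≥ v > 0` at every cold level (`K ≥ 1`), then for EVERY family of maps carrying `(A_k)`:
`Gap(ptFlowSampler t μ M φ) ≤ (1−t)·Q_0(A_0,A_0ᶜ)/((K+1)·K·v)` — order `K⁻²`, however good the hot replica, however the maps
permute or relabel the sectors. [ours] -/
theorem flowLadderEquivariantFrozen_spectralGap_le [Nontrivial S] (φ : Fin K → Equiv.Perm S) (A : Fin (K + 1) → Finset S)
    (hAφ : ∀ j : Fin K, A j.succ = (A j.castSucc).map (φ j).toEmbedding) (hK : 1 ≤ K)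
    (hμ : ∀ k x, 0 < μ k x) (hμ1 : ∀ k, ∑ u, μ k u = 1) (hM : ∀ k, IsRowStochastic (M k))
    (hMrev : ∀ k, DetailedBalance (μ k) (M k)) (ht0 : 0 ≤ t) (ht1 : t ≤ 1) {v : ℝ} (hvpos : 0 < v)
    (hv : ∀ k : Fin (K + 1), k ≠ 0 → v ≤ (∑ x ∈ A k, μ k x) * ∑ x ∈ (A k)ᶜ, μ k x)
    (hfrozen : ∀ k : Fin (K + 1), k ≠ 0 → edgeMeasure (μ k) (M k) (A k) (A k)ᶜ = 0) :
    spectralGap (tensorFun μ) (ptFlowSampler t μ M φ)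
      ≤ (1 - t) * edgeMeasure (μ 0) (M 0) (A 0) (A 0)ᶜ / ((K + 1) * (K * v)) := by
  have hKpos : (0 : ℝ) < K := Nat.cast_pos.mpr (by omega)
  -- the cold mass `Σ_k μ_k(A_k)μ_k(A_kᶜ) ≥ K·v`
  have hVge : (K : ℝ) * v ≤ ∑ k : Fin (K + 1), (∑ x ∈ A k, μ k x) * ∑ x ∈ (A k)ᶜ, μ k x := by
    rw [Fin.sum_univ_succ]
    have h0 : 0 ≤ (∑ x ∈ A 0, μ 0 x) * ∑ x ∈ (A 0)ᶜ, μ 0 x :=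
      mul_nonneg (sum_nonneg fun u _ => (hμ 0 u).le) (sum_nonneg fun u _ => (hμ 0 u).le)
    calc (K : ℝ) * v = ∑ _j : Fin K, v := by rw [Finset.sum_const, Finset.card_univ, Fintype.card_fin, nsmul_eq_mul]
      _ ≤ ∑ j : Fin K, (∑ x ∈ A j.succ, μ j.succ x) * ∑ x ∈ (A j.succ)ᶜ, μ j.succ x :=
          sum_le_sum fun j _ => hv j.succ (Fin.succ_ne_zero j)
      _ ≤ _ := le_add_of_nonneg_left h0
  have hA : 0 < ∑ k, (∑ x ∈ A k, μ k x) * ∑ x ∈ (A k)ᶜ, μ k x := lt_of_lt_of_le (mul_pos hKpos hvpos) hVge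
  have h := flowLadderEquivariant_spectralGap_le φ A hAφ hμ hμ1 hM hMrev ht0 ht1 hA
  have hsum : ∑ k : Fin (K + 1), edgeMeasure (μ k) (M k) (A k) (A k)ᶜ = edgeMeasure (μ 0) (M 0) (A 0) (A 0)ᶜ := by
    rw [Finset.sum_eq_single (0 : Fin (K + 1)) (fun k _ hk => hfrozen k hk) (fun h => absurd (mem_univ _) h)]
  rw [hsum] at h
  have hnum : 0 ≤ (1 - t) * edgeMeasure (μ 0) (M 0) (A 0) (A 0)ᶜ :=
    mul_nonneg (by linarith) (edgeMeasure_nonneg (fun u => (hμ 0 u).le) (hM 0).1 _ _)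
  refine h.trans (div_le_div_of_nonneg_left hnum (by positivity) ?_)
  exact mul_le_mul_of_nonneg_left hVge (by positivity)

end Summit.Ventures.LatticeQCDFlow.Scaling

end
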